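import Summits.ResolutionOfSingularities.ResolutionOfSingularities.Theorems.FrobeniusLadderFInjectiveMacaulayficationReesChartCongr
import Summits.ResolutionOfSingularities.ResolutionOfSingularities.Theorems.FrobeniusLadderFInjectiveMacaulayficationBlowupFiModelOfCover
import Summits.ResolutionOfSingularities.ResolutionOfSingularities.Theorems.FrobeniusLadderFInjectiveMacaulayficationDegreeZeroDescentLocal
import HarnessLib

/-!
# `PFix` IS INVARIANT UNDER RING ISOMORPHISMS OF THE LOCAL RING (instance-ledger row I11, part 1)
# (crux `FrobeniusLadder.FInjectiveMacaulayfication` stmt-ResolutionOfSingularities-15315, chain w45a, road B; res-L1-w45a-plan-1 R12.19 (a);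
# seat res-L1-w45a-stub-2)

[OURS · L1 W4.5a] AI-written; AI review is weaker than expert review. NOT a statement of any manuscript; no named fact.

`PFix(O)` — the ring-local point-fixability currency of the w45a chain (text VERBATIM as in the conclusion of
`PointFixableOfCert.pointFixable_of_cert`, p516612): some `c : Fin n → O` with `(c) ≠ 0`, `√(c) = 𝔪_O`, such that every prime `𝔔` of every
affine blow-up algebra `O[(c)/c_j]` lying over `𝔪_O` has a localisation that is a domain, Cohen–Macaulay and with all parameter ideals
Frobenius closed. THEOREM `pointFixable_of_ringEquiv`: for a ring isomorphism `e : O ≃+* O'` of local rings, `PFix(O) → PFix(O')`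
(transport `c ↦ e ∘ c`; the blow-up algebras are isomorphic over `e` by `ReesChartCongr.exists_blowupAlgebra_congr`, the localisations
by `BlowupFiModelOfCover.nonempty_ringEquiv_localization_of_ringEquiv`, the clause by `DegreeZeroDescent.inlineClause_of_ringEquiv`).
Consumer: the bridge `h0` of the specimen doors (`T11SpecimenDoor`, R12.24) from the road-B instance on the hypersurface model to the
c.i. model (part 2, `T11PlusOriginTransport`). No definitions, no named facts. [folklore]
-/

set_option linter.dupNamespace false

noncomputable section

open Literature.AlgebraicGeometry.Resolution

namespace Summit.ResolutionOfSingularities.ResolutionOfSingularities.Theorems.FInjectiveMacaulayfication.PointFixableTransport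

open Summit.ResolutionOfSingularities.ResolutionOfSingularities.Theorems.FInjectiveMacaulayfication

universe u v

/-- Membership in the maximal ideal is preserved and reflected by a ring isomorphism of local rings. [folklore] -/
theorem mem_maximalIdeal_iff {O : Type u} {O' : Type v} [CommRing O] [CommRing O'] [IsLocalRing O] [IsLocalRing O']
    (e : O ≃+* O') (x : O) : e x ∈ IsLocalRing.maximalIdeal O' ↔ x ∈ IsLocalRing.maximalIdeal O := by
  rw [IsLocalRing.mem_maximalIdeal, IsLocalRing.mem_maximalIdeal, mem_nonunits_iff, mem_nonunits_iff, isUnit_map_iff]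

/-- The maximal ideal pulls back to the maximal ideal along a ring isomorphism of local rings. [folklore] -/
theorem comap_maximalIdeal {O : Type u} {O' : Type v} [CommRing O] [CommRing O'] [IsLocalRing O] [IsLocalRing O']
    (e : O ≃+* O') : (IsLocalRing.maximalIdeal O').comap e = IsLocalRing.maximalIdeal O := by
  ext x
  rw [Ideal.mem_comap]
  exact mem_maximalIdeal_iff e x

/-- The span of the transported tuple is the image ideal. [folklore] -/
theorem span_range_comp {O : Type u} {O' : Type v} [CommRing O] [CommRing O'] (e : O ≃+* O') {n : ℕ} (c : Fin n → O) :
    Ideal.span (Set.range fun j : Fin n => e (c j)) = Ideal.map e (Ideal.span (Set.range c)) := by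
  rw [Ideal.map_span, ← Set.range_comp]
  rfl

/-- The blow-up algebras of `(c)` and of its transport `(e ∘ c)` are isomorphic over `e` (from `ReesChartCongr.exists_blowupAlgebra_congr`,
with the target ideal / denominator rewritten). [folklore] -/
theorem exists_blowupAlgebra_congr' {O : Type u} {O' : Type v} [CommRing O] [CommRing O'] (e : O ≃+* O') (I : Ideal O) (a : O)
    (I' : Ideal O') (a' : O') (hI' : I' = Ideal.map e I) (ha' : a' = e a) :
    ∃ E : blowupAlgebra I a ≃+* blowupAlgebra I' a',
      ∀ r : O, E (algebraMap O (blowupAlgebra I a) r) = algebraMap O' (blowupAlgebra I' a') (e r) := by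
  subst hI' ha'
  exact ReesChartCongr.exists_blowupAlgebra_congr e I a

/-- **`PFix` TRANSPORTS ALONG RING ISOMORPHISMS OF LOCAL RINGS.** [folklore] -/
theorem pointFixable_of_ringEquiv (p : ℕ) {O : Type} {O' : Type} [CommRing O] [CommRing O'] [IsLocalRing O] [IsLocalRing O']
    (e : O ≃+* O')
    (h : ∃ (n : ℕ) (c : Fin n → O), Ideal.span (Set.range c) ≠ ⊥ ∧ (Ideal.span (Set.range c)).radical = IsLocalRing.maximalIdeal O ∧
        ∀ (j : Fin n) (𝔔 : PrimeSpectrum (Literature.AlgebraicGeometry.Resolution.blowupAlgebra (Ideal.span (Set.range c)) (c j))),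
          𝔔.asIdeal.comap (algebraMap O (Literature.AlgebraicGeometry.Resolution.blowupAlgebra (Ideal.span (Set.range c)) (c j))) = IsLocalRing.maximalIdeal O →
          IsDomain (Localization.AtPrime 𝔔.asIdeal) ∧ ∀ d : ℕ, ringKrullDim (Localization.AtPrime 𝔔.asIdeal) = d → ∀ s : Fin d → Localization.AtPrime 𝔔.asIdeal, (Ideal.span (Set.range s)).radical.IsMaximal → RingTheory.Sequence.IsWeaklyRegular (Localization.AtPrime 𝔔.asIdeal) (List.ofFn s) ∧ ∀ y : Localization.AtPrime 𝔔.asIdeal, (∃ e : ℕ, y ^ p ^ e ∈ Ideal.span ((fun z : Localization.AtPrime 𝔔.asIdeal => z ^ p ^ e) '' (Ideal.span (Set.range s) : Set (Localization.AtPrime 𝔔.asIdeal)))) → y ∈ Ideal.span (Set.range s)) :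
    (∃ (n : ℕ) (c : Fin n → O'), Ideal.span (Set.range c) ≠ ⊥ ∧ (Ideal.span (Set.range c)).radical = IsLocalRing.maximalIdeal O' ∧
        ∀ (j : Fin n) (𝔔 : PrimeSpectrum (Literature.AlgebraicGeometry.Resolution.blowupAlgebra (Ideal.span (Set.range c)) (c j))),
          𝔔.asIdeal.comap (algebraMap O' (Literature.AlgebraicGeometry.Resolution.blowupAlgebra (Ideal.span (Set.range c)) (c j))) = IsLocalRing.maximalIdeal O' →
          IsDomain (Localization.AtPrime 𝔔.asIdeal) ∧ ∀ d : ℕ, ringKrullDim (Localization.AtPrime 𝔔.asIdeal) = d → ∀ s : Fin d → Localization.AtPrime 𝔔.asIdeal, (Ideal.span (Set.range s)).radical.IsMaximal → RingTheory.Sequence.IsWeaklyRegular (Localization.AtPrime 𝔔.asIdeal) (List.ofFn s) ∧ ∀ y : Localization.AtPrime 𝔔.asIdeal, (∃ e : ℕ, y ^ p ^ e ∈ Ideal.span ((fun z : Localization.AtPrime 𝔔.asIdeal => z ^ p ^ e) '' (Ideal.span (Set.range s) : Set (Localization.AtPrime 𝔔.asIdeal)))) → y ∈ Ideal.span (Set.range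 s)) := by
  obtain ⟨n, c, hne, hrad, hcl⟩ := h
  have hI : Ideal.span (Set.range fun j : Fin n => e (c j)) = Ideal.map e (Ideal.span (Set.range c)) := span_range_comp e c
  refine ⟨n, fun j => e (c j), ?_, ?_, ?_⟩
  · -- `(e ∘ c) ≠ 0`
    rw [hI]
    exact fun h0 => hne ((Ideal.map_eq_bot_iff_of_injective e.injective).mp h0)
  · -- `√(e ∘ c) = 𝔪_{O'}`
    rw [hI, ← Ideal.comap_symm, ← Ideal.comap_radical, hrad]
    exact comap_maximalIdeal e.symm
  · intro j 𝔔' h𝔔'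
    obtain ⟨E, hE⟩ := exists_blowupAlgebra_congr' e (Ideal.span (Set.range c)) (c j) _ _ hI rfl
    -- the prime `𝔔 = E⁻¹ 𝔔'` of `O[(c)/c_j]` lies over `𝔪_O`
    let 𝔔 : PrimeSpectrum (blowupAlgebra (Ideal.span (Set.range c)) (c j)) := ⟨𝔔'.asIdeal.comap E.toRingHom, Ideal.comap_isPrime _ _⟩
    have h𝔔 : 𝔔.asIdeal.comap (algebraMap O (blowupAlgebra (Ideal.span (Set.range c)) (c j))) = IsLocalRing.maximalIdeal O := by
      ext x
      rw [Ideal.mem_comap, show x ∈ IsLocalRing.maximalIdeal O ↔ e x ∈ IsLocalRing.maximalIdeal O' from (mem_maximalIdeal_iff e x).symm,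
        ← h𝔔', Ideal.mem_comap]
      show E (algebraMap O _ x) ∈ 𝔔'.asIdeal ↔ algebraMap O' _ (e x) ∈ 𝔔'.asIdeal
      rw [hE x]
    obtain ⟨hdom, hclause⟩ := hcl j 𝔔 h𝔔
    -- the localisations correspond
    haveI := 𝔔.isPrime
    haveI := 𝔔'.isPrime
    obtain ⟨eL⟩ := BlowupFiModelOfCover.nonempty_ringEquiv_localization_of_ringEquiv E 𝔔.asIdeal 𝔔'.asIdeal (fun x => Iff.rfl)
    haveI := hdom
    exact ⟨MulEquiv.isDomain (Localization.AtPrime 𝔔.asIdeal) eL.symm.toMulEquiv,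
      DegreeZeroDescent.inlineClause_of_ringEquiv p eL hclause⟩

end Summit.ResolutionOfSingularities.ResolutionOfSingularities.Theorems.FInjectiveMacaulayfication.PointFixableTransport

end
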